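import Summits.ValiantsHypothesis.ValiantsHypothesis.Theorems.LiftNullstellensatzLiftWidthPerFourTensorTrain
import Summits.ValiantsHypothesis.ValiantsHypothesis.Theorems.LiftNullstellensatzLiftWidthPerFourCaseB
import Summits.ValiantsHypothesis.ValiantsHypothesis.Theorems.LiftNullstellensatzLiftWidthPerFourSameRow
import Summits.ValiantsHypothesis.ValiantsHypothesis.Theorems.LiftNullstellensatzLiftWidthPerFourClaimF
import Summits.ValiantsHypothesis.ValiantsHypothesis.Theorems.LiftNullstellensatzLiftWidthPerFourBridgeLemmas

/-!
# Route LiftNullstellensatz — `LiftWidthPerFour` (item stmt-ValiantsHypothesis-5922):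
reduction of the thesis to CASE A

`liftWidthPerFour_of_caseA`: the route thesis `LiftWidthPerFour` follows from the single
algebraic statement CASE A — `per_4` has no homogeneous ABP of format `(≤5, ≤5, ≤5)` whose
first-layer forms lie in `span(x_{i,0..3}, ℓ)` and last-layer forms in `span(x_{i',0..3}, ℓ')`
for two DISTINCT rows `i ≠ i'`.  Proof: by `liftWidthPerFour_of_forall_abp` it suffices to
exclude every ABP; the common kernel of the first-layer forms is a linear space of dimension
`≥ 11` on which `per` vanishes, hence (Claim F, `linearSpace_perm4_row_or_col`) the first-layer
forms contain a full row or column of variables, and lie in the span of it and one further form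
(`exists_extra_generator`); same for the last layer.  Same row ⇒ `perPoly_not_mem_rowIdeal_mul_rowIdeal`
(R2); row and column ⇒ `perPoly_not_mem_rowIdeal_mul_colIdeal` (R3); two columns ⇒ transpose
(`rename Prod.swap` fixes `perPoly`) to two rows; two distinct rows ⇒ CASE A.  No new definitions.
-/

noncomputable section

open MvPolynomial Literature.Computability.AlgebraicComplexity

namespace Summit.ValiantsHypothesis.LiftNullstellensatz

/-- One extra generator, for an arbitrary injective family of four variables (rows or columns).
[folklore] -/
theorem exists_extra_generator_of_injective {K : Type*} [Field K] (v : Fin 4 → Fin 4 × Fin 4)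
    (hv : Function.Injective v) {a : ℕ} (ha : a ≤ 5)
    (ℓ₁ : Fin a → MvPolynomial (Fin 4 × Fin 4) K) (hlin : ∀ k, (ℓ₁ k).IsHomogeneous 1)
    (hX : ∀ j, (X (v j) : MvPolynomial (Fin 4 × Fin 4) K) ∈ Submodule.span K (Set.range ℓ₁)) :
    ∃ ℓ : MvPolynomial (Fin 4 × Fin 4) K, ℓ.IsHomogeneous 1 ∧
      ∀ k, ℓ₁ k ∈ Submodule.span K
        (insert ℓ (Set.range fun j : Fin 4 => (X (v j) : MvPolynomial (Fin 4 × Fin 4) K))) := by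
  classical
  set U : Submodule K (MvPolynomial (Fin 4 × Fin 4) K) :=
    Submodule.span K (Set.range fun j : Fin 4 => (X (v j) : MvPolynomial (Fin 4 × Fin 4) K)) with hU
  set T : Submodule K (MvPolynomial (Fin 4 × Fin 4) K) := Submodule.span K (Set.range ℓ₁) with hT
  have hTdim : Module.finrank K T ≤ 5 :=
    (finrank_range_le_card ℓ₁).trans (by rw [Fintype.card_fin]; exact ha)
  have hind : LinearIndependent K (fun j : Fin 4 => (X (v j) : MvPolynomial (Fin 4 × Fin 4) K)) :=
    (MvPolynomial.linearIndependent_X (Fin 4 × Fin 4) K).comp v hv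
  have hUdim : Module.finrank K U = 4 := by
    rw [hU, finrank_span_eq_card hind, Fintype.card_fin]
  by_cases hall : ∀ k, ℓ₁ k ∈ U
  · exact ⟨0, isHomogeneous_zero _ _ _, fun k => Submodule.span_mono (Set.subset_insert _ _) (hall k)⟩
  · push Not at hall
    obtain ⟨k₀, hk₀⟩ := hall
    refine ⟨ℓ₁ k₀, hlin k₀, fun k => ?_⟩
    set U' : Submodule K (MvPolynomial (Fin 4 × Fin 4) K) := Submodule.span K
      (insert (ℓ₁ k₀) (Set.range fun j : Fin 4 => (X (v j) : MvPolynomial (Fin 4 × Fin 4) K)))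
      with hU'
    have hUU' : U < U' := by
      refine lt_of_le_of_ne (Submodule.span_mono (Set.subset_insert _ _)) ?_
      intro hEq
      exact hk₀ (hEq ▸ Submodule.subset_span (Set.mem_insert _ _))
    have hU'T : U' ≤ T := Submodule.span_le.2 (by
      rintro _ (rfl | ⟨j, rfl⟩)
      · exact Submodule.subset_span ⟨k₀, rfl⟩
      · exact hX j)
    haveI : FiniteDimensional K U' := FiniteDimensional.span_of_finite K (Set.toFinite _)
    haveI : FiniteDimensional K T := FiniteDimensional.span_of_finite K (Set.finite_range _)
    have h5 : 5 ≤ Module.finrank K U' := by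
      have := Submodule.finrank_lt_finrank_of_lt hUU'
      omega
    have hEq : U' = T := Submodule.eq_of_le_of_finrank_le hU'T (hTdim.trans h5)
    have : ℓ₁ k ∈ T := Submodule.subset_span ⟨k, rfl⟩
    rw [← hEq] at this
    exact this

/-- The first (or last) layer of a homogeneous width-`≤ 5` ABP computing `per_4`: its linear
forms lie in `span(x_{i,·}, ℓ)` for some row `i` or in `span(x_{·,j}, ℓ)` for some column `j`
(Claim F + duality + dimension count). [folklore] -/
theorem layer_normal_form {a : ℕ} (ha : a ≤ 5) (L₁ : Fin 4 × Fin 4 → Fin a → ℂ)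
    (hvan : ∀ A : Matrix (Fin 4) (Fin 4) ℂ, (∀ k, ∑ x, L₁ x k * A x.1 x.2 = 0) → A.permanent = 0) :
    ∃ ℓ : MvPolynomial (Fin 4 × Fin 4) ℂ, ℓ.IsHomogeneous 1 ∧
      ((∃ i : Fin 4, ∀ k, (∑ x, L₁ x k • (X x : MvPolynomial (Fin 4 × Fin 4) ℂ)) ∈ Submodule.span ℂ
          (insert ℓ (Set.range fun j : Fin 4 => (X (i, j) : MvPolynomial (Fin 4 × Fin 4) ℂ)))) ∨
       (∃ j : Fin 4, ∀ k, (∑ x, L₁ x k • (X x : MvPolynomial (Fin 4 × Fin 4) ℂ)) ∈ Submodule.span ℂ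
          (insert ℓ (Set.range fun i : Fin 4 => (X (i, j) : MvPolynomial (Fin 4 × Fin 4) ℂ))))) := by
  classical
  -- the common kernel of the layer's functionals
  let Φ : Matrix (Fin 4) (Fin 4) ℂ →ₗ[ℂ] (Fin a → ℂ) :=
    LinearMap.pi fun k => ∑ x : Fin 4 × Fin 4, L₁ x k • Matrix.entryLinearMap ℂ ℂ x.1 x.2
  have hΦ : ∀ A k, Φ A k = ∑ x, L₁ x k * A x.1 x.2 := by
    intro A k
    simp only [Φ, LinearMap.pi_apply, LinearMap.coe_sum, Finset.sum_apply, LinearMap.smul_apply,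
      Matrix.entryLinearMap_apply, smul_eq_mul]
  set W : Submodule ℂ (Matrix (Fin 4) (Fin 4) ℂ) := LinearMap.ker Φ with hW
  have hWmem : ∀ A, A ∈ W ↔ ∀ k, ∑ x, L₁ x k * A x.1 x.2 = 0 := by
    intro A
    rw [hW, LinearMap.mem_ker]
    constructor
    · intro h k; rw [← hΦ, h]; rfl
    · intro h; funext k; rw [hΦ]; exact h k
  have hdim : 11 ≤ Module.finrank ℂ W := by
    have h1 := LinearMap.finrank_range_add_finrank_ker Φ
    have h2 : Module.finrank ℂ (Matrix (Fin 4) (Fin 4) ℂ) = 16 := by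
      rw [Module.finrank_matrix]; simp
    have h3 : Module.finrank ℂ (LinearMap.range Φ) ≤ a := by
      calc Module.finrank ℂ (LinearMap.range Φ) ≤ Module.finrank ℂ (Fin a → ℂ) :=
            Submodule.finrank_le _
        _ = a := by simp
    rw [hW]; omega
  have hper : ∀ A ∈ W, A.permanent = 0 := fun A hA => hvan A ((hWmem A).1 hA)
  have hlin : ∀ k, (∑ x, L₁ x k • (X x : MvPolynomial (Fin 4 × Fin 4) ℂ)).IsHomogeneous 1 :=
    fun k => IsHomogeneous.sum _ _ _ fun x _ => by
      rw [smul_eq_C_mul]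
      simpa using (isHomogeneous_C (Fin 4 × Fin 4) (L₁ x k)).mul (isHomogeneous_X ℂ x)
  rcases linearSpace_perm4_row_or_col (K := ℂ) two_ne_zero W hdim hper with ⟨i, hi⟩ | ⟨j, hj⟩
  · -- row `i`: every `x_{i,j}` lies in the span of the layer forms
    have hX : ∀ j, (X (i, j) : MvPolynomial (Fin 4 × Fin 4) ℂ) ∈
        Submodule.span ℂ (Set.range fun k => ∑ x, L₁ x k • (X x : MvPolynomial (Fin 4 × Fin 4) ℂ)) := by
      intro j
      refine X_mem_span_of_forall_kernel L₁ (i, j) fun v hv => ?_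
      exact hi (Matrix.of fun p q => v (p, q)) ((hWmem _).2 (by simpa using hv)) j
    obtain ⟨ℓ, hℓ, hmem⟩ := exists_extra_generator_of_injective (K := ℂ) (fun j => (i, j))
      (fun j j' h => (Prod.mk.inj h).2) ha _ hlin hX
    exact ⟨ℓ, hℓ, Or.inl ⟨i, hmem⟩⟩
  · have hX : ∀ i, (X (i, j) : MvPolynomial (Fin 4 × Fin 4) ℂ) ∈
        Submodule.span ℂ (Set.range fun k => ∑ x, L₁ x k • (X x : MvPolynomial (Fin 4 × Fin 4) ℂ)) := by
      intro i
      refine X_mem_span_of_forall_kernel L₁ (i, j) fun v hv => ?_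
      exact hj (Matrix.of fun p q => v (p, q)) ((hWmem _).2 (by simpa using hv)) i
    obtain ⟨ℓ, hℓ, hmem⟩ := exists_extra_generator_of_injective (K := ℂ) (fun i => (i, j))
      (fun i i' h => (Prod.mk.inj h).1) ha _ hlin hX
    exact ⟨ℓ, hℓ, Or.inr ⟨j, hmem⟩⟩

/-- Membership transfer: a `K`-linear combination of elements of a set lies in the ideal it
generates. [folklore] -/
theorem mem_idealSpan_of_mem_span {K : Type*} [Field K] {σ : Type*} {s : Set (MvPolynomial σ K)}
    {f : MvPolynomial σ K} (hf : f ∈ Submodule.span K s) : f ∈ Ideal.span s := by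
  refine Submodule.span_induction (p := fun f _ => f ∈ Ideal.span s) (fun x hx => Ideal.subset_span hx)
    (Ideal.zero_mem _) (fun x y _ _ hx hy => Ideal.add_mem _ hx hy) (fun a x _ hx => ?_) hf
  rw [smul_eq_C_mul]; exact Ideal.mul_mem_left _ _ hx

/-- `rename Prod.swap` (transposition of the variable matrix) fixes the generic permanent.
[folklore] -/
theorem rename_swap_perPoly (n : ℕ) :
    rename Prod.swap (perPoly (Fin n) ℂ) = perPoly (Fin n) ℂ := by
  unfold perPoly
  rw [← AlgHom.coe_toRingHom, ← permanent_map_ringHom, ← Matrix.permanent_transpose]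
  congr 1
  ext i j
  simp [Matrix.mvPolynomialX]

/-- **Reduction of `LiftWidthPerFour` to CASE A.**  CASE A (the hypothesis): for rows `i ≠ i'`,
linear forms `ℓ, ℓ'`, and any homogeneous ABP of format `(a, b, c) ≤ (5, 5, 5)` whose first-layer
forms lie in `span(x_{i,0..3}, ℓ)` and last-layer forms in `span(x_{i',0..3}, ℓ')`, the computed
polynomial is not `per_4`.  Conclusion: the route thesis. -/
theorem liftWidthPerFour_of_caseA
    (HA : ∀ i i' : Fin 4, i ≠ i' → ∀ ℓ ℓ' : MvPolynomial (Fin 4 × Fin 4) ℂ,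
      ℓ.IsHomogeneous 1 → ℓ'.IsHomogeneous 1 → ∀ a b c : ℕ, a ≤ 5 → b ≤ 5 → c ≤ 5 →
      ∀ (L₁ : Fin 4 × Fin 4 → Fin a → ℂ) (L₂ : Fin 4 × Fin 4 → Fin a → Fin b → ℂ)
        (L₃ : Fin 4 × Fin 4 → Fin b → Fin c → ℂ) (L₄ : Fin 4 × Fin 4 → Fin c → ℂ),
      (∀ k, (∑ x, L₁ x k • (X x : MvPolynomial (Fin 4 × Fin 4) ℂ)) ∈ Submodule.span ℂ
          (insert ℓ (Set.range fun j : Fin 4 => (X (i, j) : MvPolynomial (Fin 4 × Fin 4) ℂ)))) →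
      (∀ t, (∑ x, L₄ x t • (X x : MvPolynomial (Fin 4 × Fin 4) ℂ)) ∈ Submodule.span ℂ
          (insert ℓ' (Set.range fun j : Fin 4 => (X (i', j) : MvPolynomial (Fin 4 × Fin 4) ℂ)))) →
      perPoly (Fin 4) ℂ ≠ ∑ k, ∑ s, ∑ t,
        (∑ x, L₁ x k • (X x : MvPolynomial (Fin 4 × Fin 4) ℂ)) * (∑ x, L₂ x k s • X x) *
        (∑ x, L₃ x s t • X x) * (∑ x, L₄ x t • X x)) :
    Summit.ValiantsHypothesis.ValiantsHypothesis.Theses.LiftNullstellensatz.LiftWidthPerFour := by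
  classical
  -- Main dispatch, for an arbitrary ABP: rows for both layers or a row/column mix lead to a
  -- contradiction directly; the column/column case is reduced to it by transposition below.
  have main : ∀ a b c : ℕ, a ≤ 5 → b ≤ 5 → c ≤ 5 →
      ∀ (L₁ : Fin 4 × Fin 4 → Fin a → ℂ) (L₂ : Fin 4 × Fin 4 → Fin a → Fin b → ℂ)
        (L₃ : Fin 4 × Fin 4 → Fin b → Fin c → ℂ) (L₄ : Fin 4 × Fin 4 → Fin c → ℂ),
      perPoly (Fin 4) ℂ = ∑ k, ∑ s, ∑ t,
        (∑ x, L₁ x k • (X x : MvPolynomial (Fin 4 × Fin 4) ℂ)) * (∑ x, L₂ x k s • X x) *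
        (∑ x, L₃ x s t • X x) * (∑ x, L₄ x t • X x) →
      -- unless both layers are of column type
      ¬ ((∃ (ℓ : MvPolynomial (Fin 4 × Fin 4) ℂ) (j : Fin 4), ℓ.IsHomogeneous 1 ∧ ∀ k,
            (∑ x, L₁ x k • (X x : MvPolynomial (Fin 4 × Fin 4) ℂ)) ∈ Submodule.span ℂ
              (insert ℓ (Set.range fun i : Fin 4 => (X (i, j) : MvPolynomial (Fin 4 × Fin 4) ℂ)))) ∧
         (∃ (ℓ' : MvPolynomial (Fin 4 × Fin 4) ℂ) (j' : Fin 4), ℓ'.IsHomogeneous 1 ∧ ∀ t,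
            (∑ x, L₄ x t • (X x : MvPolynomial (Fin 4 × Fin 4) ℂ)) ∈ Submodule.span ℂ
              (insert ℓ' (Set.range fun i : Fin 4 => (X (i, j') : MvPolynomial (Fin 4 × Fin 4) ℂ))))) →
      False := by
    intro a b c ha hb hc L₁ L₂ L₃ L₄ hEq hnotcc
    -- per vanishes on the common kernels of layer 1 and of layer 4
    have hvan1 : ∀ A : Matrix (Fin 4) (Fin 4) ℂ, (∀ k, ∑ x, L₁ x k * A x.1 x.2 = 0) →
        A.permanent = 0 := by
      intro A hA
      have := congrArg (eval fun x : Fin 4 × Fin 4 => A x.1 x.2) hEq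
      rw [eval_perPoly_eq_permanent] at this
      rw [this]
      simp only [map_sum, map_mul, smul_eval, eval_X, hA, zero_mul, Finset.sum_const_zero]
    have hvan4 : ∀ A : Matrix (Fin 4) (Fin 4) ℂ, (∀ t, ∑ x, L₄ x t * A x.1 x.2 = 0) →
        A.permanent = 0 := by
      intro A hA
      have := congrArg (eval fun x : Fin 4 × Fin 4 => A x.1 x.2) hEq
      rw [eval_perPoly_eq_permanent] at this
      rw [this]
      simp only [map_sum, map_mul, smul_eval, eval_X, hA, mul_zero, Finset.sum_const_zero]
    -- the product ideal membership
    have hmemII : ∀ (s₁ s₄ : Set (MvPolynomial (Fin 4 × Fin 4) ℂ)),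
        (∀ k, (∑ x, L₁ x k • (X x : MvPolynomial (Fin 4 × Fin 4) ℂ)) ∈ Submodule.span ℂ s₁) →
        (∀ t, (∑ x, L₄ x t • (X x : MvPolynomial (Fin 4 × Fin 4) ℂ)) ∈ Submodule.span ℂ s₄) →
        perPoly (Fin 4) ℂ ∈ Ideal.span s₁ * Ideal.span s₄ := by
      intro s₁ s₄ h1 h4
      rw [hEq]
      refine Ideal.sum_mem _ fun k _ => Ideal.sum_mem _ fun s _ => Ideal.sum_mem _ fun t _ => ?_
      have e : (∑ x, L₁ x k • (X x : MvPolynomial (Fin 4 × Fin 4) ℂ)) * (∑ x, L₂ x k s • X x) *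
          (∑ x, L₃ x s t • X x) * (∑ x, L₄ x t • X x) =
          ((∑ x, L₁ x k • (X x : MvPolynomial (Fin 4 × Fin 4) ℂ)) * ((∑ x, L₂ x k s • X x) *
          (∑ x, L₃ x s t • X x))) * (∑ x, L₄ x t • X x) := by ring
      rw [e]
      exact Ideal.mul_mem_mul (Ideal.mul_mem_right _ _ (mem_idealSpan_of_mem_span (h1 k)))
        (mem_idealSpan_of_mem_span (h4 t))
    obtain ⟨ℓ, hℓ, h1⟩ := layer_normal_form ha L₁ hvan1
    obtain ⟨ℓ', hℓ', h4⟩ := layer_normal_form hc L₄ hvan4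
    rcases h1 with ⟨i, hi⟩ | ⟨j, hj⟩
    · rcases h4 with ⟨i', hi'⟩ | ⟨j', hj'⟩
      · by_cases hii : i = i'
        · subst hii
          exact perPoly_not_mem_rowIdeal_mul_rowIdeal (K := ℂ) two_ne_zero i ℓ ℓ' hℓ hℓ'
            (hmemII _ _ hi hi')
        · exact HA i i' hii ℓ ℓ' hℓ hℓ' a b c ha hb hc L₁ L₂ L₃ L₄ hi hi' hEq
      · exact perPoly_not_mem_rowIdeal_mul_colIdeal (K := ℂ) two_ne_zero i j' ℓ ℓ' hℓ hℓ'
          (hmemII _ _ hi hj')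
    · rcases h4 with ⟨i', hi'⟩ | ⟨j', hj'⟩
      · have := hmemII _ _ hj hi'
        rw [mul_comm] at this
        exact perPoly_not_mem_rowIdeal_mul_colIdeal (K := ℂ) two_ne_zero i' j ℓ' ℓ hℓ' hℓ this
      · exact hnotcc ⟨⟨ℓ, j, hℓ, hj⟩, ⟨ℓ', j', hℓ', hj'⟩⟩
  -- now the thesis
  refine liftWidthPerFour_of_forall_abp fun a b c ha hb hc L₁ L₂ L₃ L₄ hEq => ?_
  refine main a b c ha hb hc L₁ L₂ L₃ L₄ hEq fun hcc => ?_
  -- column/column: transpose the whole ABP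
  obtain ⟨⟨ℓ, j, hℓ, hj⟩, ⟨ℓ', j', hℓ', hj'⟩⟩ := hcc
  let τ : MvPolynomial (Fin 4 × Fin 4) ℂ →ₐ[ℂ] MvPolynomial (Fin 4 × Fin 4) ℂ := rename Prod.swap
  have hτlin : ∀ (L : Fin 4 × Fin 4 → ℂ), τ (∑ x, L x • (X x : MvPolynomial (Fin 4 × Fin 4) ℂ)) =
      ∑ x, L x.swap • (X x : MvPolynomial (Fin 4 × Fin 4) ℂ) := by
    intro L
    simp only [τ, map_sum, map_smul, rename_X]
    exact Fintype.sum_equiv (Equiv.prodComm (Fin 4) (Fin 4)) _ _ fun x => by simp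
  have hEq' : perPoly (Fin 4) ℂ = ∑ k, ∑ s, ∑ t,
      (∑ x, (fun x k => L₁ x.swap k) x k • (X x : MvPolynomial (Fin 4 × Fin 4) ℂ)) *
      (∑ x, (fun x k s => L₂ x.swap k s) x k s • X x) *
      (∑ x, (fun x s t => L₃ x.swap s t) x s t • X x) * (∑ x, (fun x t => L₄ x.swap t) x t • X x) := by
    have := congrArg τ hEq
    rw [show τ (perPoly (Fin 4) ℂ) = perPoly (Fin 4) ℂ from rename_swap_perPoly 4] at this
    rw [this]
    simp only [map_sum, map_mul, hτlin]
  refine main a b c ha hb hc _ _ _ _ hEq' ?_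
  -- after transposition both layers are of ROW type, so `main` cannot return the col/col case
  intro hcc'
  -- transposed memberships: layer 1 in row `j`, layer 4 in row `j'`
  have hτmem : ∀ (L : Fin 4 × Fin 4 → ℂ) (m : MvPolynomial (Fin 4 × Fin 4) ℂ) (j₀ : Fin 4),
      (∑ x, L x • (X x : MvPolynomial (Fin 4 × Fin 4) ℂ)) ∈ Submodule.span ℂ
        (insert m (Set.range fun i : Fin 4 => (X (i, j₀) : MvPolynomial (Fin 4 × Fin 4) ℂ))) →
      (∑ x, L x.swap • (X x : MvPolynomial (Fin 4 × Fin 4) ℂ)) ∈ Submodule.span ℂ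
        (insert (τ m) (Set.range fun i : Fin 4 => (X (j₀, i) : MvPolynomial (Fin 4 × Fin 4) ℂ))) := by
    intro L m j₀ hm
    rw [← hτlin]
    have := Submodule.mem_map_of_mem (f := τ.toLinearMap) hm
    rw [Submodule.map_span] at this
    refine Submodule.span_mono ?_ this
    rintro _ ⟨y, hy, rfl⟩
    rcases hy with rfl | ⟨i, rfl⟩
    · exact Set.mem_insert _ _
    · refine Set.mem_insert_of_mem _ ⟨i, ?_⟩
      simp [τ]
  have hrow1 : ∀ k, (∑ x, (fun x k => L₁ x.swap k) x k • (X x : MvPolynomial (Fin 4 × Fin 4) ℂ)) ∈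
      Submodule.span ℂ (insert (τ ℓ) (Set.range fun i : Fin 4 => (X (j, i) : MvPolynomial (Fin 4 × Fin 4) ℂ))) :=
    fun k => hτmem (fun x => L₁ x k) ℓ j (hj k)
  have hrow4 : ∀ t, (∑ x, (fun x t => L₄ x.swap t) x t • (X x : MvPolynomial (Fin 4 × Fin 4) ℂ)) ∈
      Submodule.span ℂ (insert (τ ℓ') (Set.range fun i : Fin 4 => (X (j', i) : MvPolynomial (Fin 4 × Fin 4) ℂ))) :=
    fun t => hτmem (fun x => L₄ x t) ℓ' j' (hj' t)
  have hτℓ : (τ ℓ).IsHomogeneous 1 := hℓ.rename_isHomogeneous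
  have hτℓ' : (τ ℓ').IsHomogeneous 1 := hℓ'.rename_isHomogeneous
  -- dispatch the transposed ABP by rows directly
  have hmemII' : perPoly (Fin 4) ℂ ∈
      Ideal.span (insert (τ ℓ) (Set.range fun i : Fin 4 => (X (j, i) : MvPolynomial (Fin 4 × Fin 4) ℂ))) *
      Ideal.span (insert (τ ℓ') (Set.range fun i : Fin 4 => (X (j', i) : MvPolynomial (Fin 4 × Fin 4) ℂ))) := by
    rw [hEq']
    refine Ideal.sum_mem _ fun k _ => Ideal.sum_mem _ fun s _ => Ideal.sum_mem _ fun t _ => ?_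
    have e : ∀ (A B C D : MvPolynomial (Fin 4 × Fin 4) ℂ), A * B * C * D = (A * (B * C)) * D :=
      fun A B C D => by ring
    rw [e]
    exact Ideal.mul_mem_mul (Ideal.mul_mem_right _ _ (mem_idealSpan_of_mem_span (hrow1 k)))
      (mem_idealSpan_of_mem_span (hrow4 t))
  by_cases hjj : j = j'
  · subst hjj
    exact perPoly_not_mem_rowIdeal_mul_rowIdeal (K := ℂ) two_ne_zero j _ _ hτℓ hτℓ' hmemII'
  · exact HA j j' hjj _ _ hτℓ hτℓ' a b c ha hb hc _ _ _ _ hrow1 hrow4 hEq'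

end Summit.ValiantsHypothesis.LiftNullstellensatz

end
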